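import Summits.BirchSwinnertonDyer.BirchSwinnertonDyer.Theorems.KatoDescentPotSupersingularReducibleHullShaBoundCount
import Summits.BirchSwinnertonDyer.BirchSwinnertonDyer.Theorems.KatoDescentPotSupersingularZetaLineRankZero
import Summits.BirchSwinnertonDyer.BirchSwinnertonDyer.Theorems.KatoDescentPotSupersingularReducibleUpperOfCoreInputs
import Literature.NumberTheory.EllipticCurves.Kato2004.MemberHullZetaFineInputs
import Literature.NumberTheory.EllipticCurves.Kato2004.IwasawaH2FineSelmerDualCount
import Literature.NumberTheory.EllipticCurves.IsogenyNeronScalingMinimalDiscriminantDirectionProofs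
import HarnessLib

/-!
# THE ABSTRACT-`𝐇²` BLOCK OF CRUX M's HELD CORE PACKAGE IS REBUILT IN THE KERNEL: `Kato2004.exists_memberHullZetaCoreInputs`
# (27962; the constant behind M on K9 + KT and behind U₀-red's `PublishedInputKatoCorePackageU0Red[T]`) FROM the hull sub-package
# `exists_memberHullZetaFineInputs` ⊕ H2X⁺ ⊕ {Ferrero–Washington, Lim 2017 Thm. 3.5} ⊕ Imai's local finiteness

Seat `bsd-potss-rkm` g30 (prover, cell `bsd-potss`), item stmt-BirchSwinnertonDyer-19196 `ReducibleKatoMember` = crux M of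
K9 `KatoDescentPotSupersingular` (support) / K8-t′ `KatoDescentTamePotSupersingular` (auto-crux); `--supports … --as helper`;
route-free; closes nothing.  HONEST FRAMING: BSD is proved for no curve by this file; nothing is booked; crux M stays cite-level.
What changes is the SHAPE of the cited residue: the held twenty-nine-clause construction package 27962
`Kato2004.exists_memberHullZetaCoreInputs` (Kato's Euler system + explicit reciprocity at the member, size XL) is a KERNEL
CONSEQUENCE of

* `Kato2004.exists_memberHullZetaFineInputs` — its HULL SUB-PACKAGE (`Kato2004/MemberHullZetaFineInputs.lean`, seat rkm g30,
  review lane): the nineteen fields of the abstract-`𝐇²` / pinned-`A` block removed, Thm. 12.5 (3) read against the CONSTRUCTED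
  `X₀ = (W.fineSelmerDualData κ hγ).X`, the outer text of 27962 verbatim;
* `Kato2004.exists_iwasawaH2Data_fineSelmerDual_embedding_count` — H2X⁺ (`Kato2004/IwasawaH2FineSelmerDualCount.lean`, seat rkm
  g30, review lane): bsd-cm's reviewed H2X (`𝐇²_Γ ⊇ X₀` with finite cokernel, (14.9.1)) with ONE more clause for ITS `J`,
  (c2′) `KatoH2CountAt W p #(J.H2)_Γ` ((14.14.2) + (14.9.3)), guarded by `W(ℚ)`, `Ш(W)[p^∞]` finite;
* Ferrero–Washington + Lim 2017 Thm. 3.5 (Coates–Sujatha (A) on the reducible rows, Wuthrich L.14 — kernel modulo these two,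
  `ReducibleFineSelmerMuZero`), giving `μ(X₀) = 0`, hence `μ(J.H2) = 0` by pseudo-isomorphism (§1);
* the finiteness of `W_K(ℚ_{p,∞})[p^∞]` at the potentially good `p` — Imai 1975, DISPLAYED in the schema shape of bsd-cm's
  `ContraRealizable.realizableOfKMC_contra_of_thm12_4_of_h2Embedding_of_localFinite` (`hImai`; NOT minted as a fact, net debt 0;
  on the rows with `W_K(ℚ_p)[p] = 0` it is the kernel theorem `TowerTorsionVanishing…`, seat rkm g26).

The finiteness of `W_K(ℚ)` that unlocks H2X⁺'s count is NOT an input: it follows from clause (b′) of the hull sub-package itself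
(`ZetaLineRankZero.finite_point_of_zetaLineOrthIndexAt`, seat rkm g25 — Kato Cor. 14.3 / Thm. 14.5 by reciprocity + the log lattice,
Poitou–Tate over `ℚ` a tree theorem); `Ш(W_K)[p^∞]` is finite by isogeny invariance from `Ш(W)`; `W_K[p]` is reducible and
`0 ≤ ord_p j(W_K)` by isogeny invariance (`Rank1Residual.not_hasIrreducibleModPGaloisRep_of_isIsogenous`, `padicValRat_j_nonneg_of_isogeny`).

## Contents (namespace `Summit.BirchSwinnertonDyer.BirchSwinnertonDyer.Theorems.CoreInputsOfFine`)

* §1 `muInvariant_H2_eq_zero_of_fineSelmerDual_embedding` — `W[p]` reducible, `p ≠ 2`, `κ` cyclotomic: every `J : IwasawaH2Data`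
  with `X₀ ↪ J.H2` of finite cokernel has `μ(J.H2) = 0` (mod FW, Lim).
* §2 `nonempty_coreInputs_of_fineInputs` — per pin: hull sub-package + (`J`, `e_X`) + (c2′) for `J` ⟹ `MemberHullZetaCoreInputs`.
* §3 **`exists_memberHullZetaCoreInputs_of_fineInputs`** — the fact-level theorem:
  `exists_memberHullZetaFineInputs → H2X⁺ → Lim 3.5 → FW → (Imai schema) → exists_memberHullZetaCoreInputs`.
* §4 consumers, route-free: `katoMemberShaBoundOfReducible_of_newform_of_fineInputs` (the O6 node behind crux M, via g25's
  `ZetaLineRankZero.katoMemberShaBoundOfReducible_of_newform_of_coreInputs`) and `missingUpperBoundAt_of_fineInputs` (the reducible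
  upper half behind U₀-red, via `ReducibleUpperOfCoreInputs.missingUpperBoundAt_of_coreInputs'`).

References: [Kato2004Asterisque] Thm. 12.5 (pp. 221–222), 12.6 / Rem. 12.7 (p. 222), Lemma 13.10 (1) (p. 230), 13.14 (p. 234), Cor. 14.3 /
Thm. 14.5 (pp. 235–236), (14.9.1)–(14.9.3) (pp. 239–240), §14.14 (14.14.1)–(14.14.2) (p. 243), Prop. 14.16 (2) (pp. 244–245), Lemma 14.18
(pp. 247–248); [Imai1975] Theorem (p. 12); [Wuthrich2014] Lemma 14; [Lim2017FineSelmer] Thm. 3.5; [FerreroWashington1979];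
[Washington1997] §13.2; [SilvermanAEC2009] Cor. VII.7.2, Prop. VII.5.5.
-/

-- the summit and its single problem are both named `BirchSwinnertonDyer` (registry layout D-0017)
set_option linter.dupNamespace false
set_option autoImplicit false

noncomputable section

open scoped Classical NumberField TensorProduct
open Function Field NumberField IsDedekindDomain WeierstrassCurve CongruenceSubgroup
open Literature.NumberTheory.EllipticCurves Literature.NumberTheory.EllipticCurves.GreenbergSelmer
open Literature.NumberTheory.GaloisRepresentations Literature.NumberTheory.GaloisCohomology
open Literature.NumberTheory.EllipticCurves.ModularForms
open Literature.NumberTheory.EllipticCurves.Kato2004 Literature.NumberTheory.EllipticCurves.Kato2004.EulerSystemValues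
open Literature.NumberTheory.EllipticCurves.IwasawaAlgebra Literature.NumberTheory.EllipticCurves.IwasawaDual
open Literature.NumberTheory.EllipticCurves.Rank1Residual Literature.NumberTheory.EllipticCurves.Rank1Residual.Typed
open Summit.BirchSwinnertonDyer.Rank1Residual
open Summit.BirchSwinnertonDyer.BirchSwinnertonDyer.Theorems

universe u

namespace Summit.BirchSwinnertonDyer.BirchSwinnertonDyer.Theorems.CoreInputsOfFine

/-! ## §1 `μ(J.H2) = 0` for every Iwasawa descent package containing `X₀` with finite cokernel, on a reducible row -/

section Mu

variable (W : WeierstrassCurve ℚ) [W.IsElliptic] (p : ℕ) [Fact p.Prime]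
  [ContinuousSMul ℤ_[p] (W.tateModule p)] {κ : ZpExtension ℚ p} {γ : absoluteGaloisGroup ℚ}

/-- **`μ(J.H2) = 0` on the reducible rows** (`W[p]` reducible, `p ≠ 2`, `(κ, γ)` cyclotomic): for every descent package
`J : IwasawaH2Data W p κ γ I` and every injective `Λ`-linear `X₀ = (W.fineSelmerDualData κ hγ).X → J.H2` of finite cokernel,
`muInvariant p J.H2 = 0` — `μ(X₀) = 0` is Coates–Sujatha (A) on the reducible rows (Wuthrich L.14: Ferrero–Washington + Lim 3.5,
kernel `ReducibleFineSelmerMuZero`), i.e. `ℓ_{(p)}(X₀) = 0`, and an injection with finite cokernel preserves lengths at height one.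
This is the clause `mu_H2` of `MemberHullZetaCoreInputs` for `H2 := J.H2`.
[cite: Wuthrich2014, Lemma 14 (p. 396)] [cite: Lim2017FineSelmer, §3 Thm. 3.5] [cite: Washington1997, §13.2] -/
theorem muInvariant_H2_eq_zero_of_fineSelmerDual_embedding
    (hLim : Lim2017.thm35_fineSelmerDual_moduleFinite_of_classicalMuVanishes_of_le_divisionField)
    (hFW : Literature.NumberTheory.IwasawaTheory.ferreroWashington1979_classicalMuVanishes)
    (hp : p ≠ 2) (hκ : κ.IsCyclotomic) (hγ : κ.IsTopGenerator γ) (hred : ¬ W.HasIrreducibleModPGaloisRep p)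
    {I : IwasawaH1Data W p κ γ} (J : IwasawaH2Data W p κ γ I)
    (eX : (W.fineSelmerDualData κ hγ).X →ₗ[IwasawaAlgebra p] J.H2) (heX : Function.Injective eX)
    (hcokX : Finite (J.H2 ⧸ LinearMap.range eX)) :
    muInvariant p J.H2 = 0 := by
  -- `μ(X₀) = 0` on the reducible row: `X₀ / p X₀` is finite
  have hA := ReducibleFineSelmerMuZero.fineSelmerDual_moduleFinite_of_not_irreducible hLim hFW W p hp hred κ hκ
  have hfinp : Set.Finite {t : W.fineSelmerInfty κ | p • t = 0} :=
    (IwasawaModuleFinitePadicInt.exists_fineSelmerDualData_moduleFinite_iff_finite_pTorsion W κ hγ).mp hA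
  haveI : Module.Finite (IwasawaAlgebra p) (W.fineSelmerDualData κ hγ).X :=
    (W.fineSelmerDualData κ hγ).module_finite_of_finite_pTorsion hγ hfinp
  haveI : Finite ((W.fineSelmerDualData κ hγ).X ⧸
      (IwasawaAlgebra.augIdealP p • (⊤ : Submodule (IwasawaAlgebra p) (W.fineSelmerDualData κ hγ).X))) :=
    (W.fineSelmerDualData κ hγ).finite_quotient_augIdealP_of_finite_pTorsion hfinp
  -- `ℓ_{(p)}(J.H2) = ℓ_{(p)}(X₀) = 0`
  unfold muInvariant
  refine finsum_mem_of_eqOn_zero fun 𝔭 h𝔭 => ?_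
  have h𝔭' : 𝔭.asIdeal = augIdealP p := h𝔭
  have hht : 𝔭.asIdeal.height ≤ 1 := by rw [h𝔭']; exact le_of_eq (height_augIdealP_holds p)
  rw [Pi.zero_apply, ← lengthAt_eq_of_injective_of_finite_quotient eX heX hcokX 𝔭 hht,
    Rank1Residual.KatoMuSkeleton.lengthAt_eq_zero_of_finite_quotient_p (M := (W.fineSelmerDualData κ hγ).X) 𝔭 h𝔭']
  rfl

end Mu

/-! ## §2 Per pin: the hull sub-package, a package `J ⊇ X₀` and (c2′) for `J` give the core package -/

section Pointwise

variable (W : WeierstrassCurve ℚ) [W.IsElliptic] (p : ℕ) [Fact p.Prime]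
  [ContinuousSMul ℤ_[p] (W.tateModule p)] {κ : ZpExtension ℚ p} {γ : absoluteGaloisGroup ℚ}

/-- **Per pin, `MemberHullZetaFineInputs` ⊕ (`J`, `e_X`) ⊕ (c2′) for `J` ⟹ `MemberHullZetaCoreInputs`** (`W[p]` reducible, `p ≠ 2`,
`(κ, γ)` cyclotomic; modulo FW + Lim for `μ(J.H2) = 0`): the conversion `MemberHullZetaFineInputs.toCoreInputs` with `H2 := J.H2`,
§1 for `mu_H2`. [cite: Kato2004Asterisque, Thm. 12.5 (3) (p. 222), (14.9.1) (p. 239), §14.14 (14.14.1)–(14.14.2) (p. 243)] [cite: Wuthrich2014, Lemma 14 (p. 396)] -/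
theorem nonempty_coreInputs_of_fineInputs
    (hLim : Lim2017.thm35_fineSelmerDual_moduleFinite_of_classicalMuVanishes_of_le_divisionField)
    (hFW : Literature.NumberTheory.IwasawaTheory.ferreroWashington1979_classicalMuVanishes)
    (hp : p ≠ 2) (hκ : κ.IsCyclotomic) (hγ : κ.IsTopGenerator γ) (hred : ¬ W.HasIrreducibleModPGaloisRep p)
    {I : IwasawaH1Data W p κ γ} {y : I.H} (Z : MemberHullZetaFineInputs W p κ γ hγ I y)
    (J : IwasawaH2Data W p κ γ I)
    (eX : (W.fineSelmerDualData κ hγ).X →ₗ[IwasawaAlgebra p] J.H2) (heX : Function.Injective eX)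
    (hcokX : Finite (J.H2 ⧸ LinearMap.range eX)) (hcount : KatoH2CountAt W p (Nat.card (coinvariants p J.H2))) :
    Nonempty (MemberHullZetaCoreInputs W p κ γ I y) :=
  ⟨Z.toCoreInputs J eX heX hcokX
    (muInvariant_H2_eq_zero_of_fineSelmerDual_embedding W p hLim hFW hp hκ hγ hred J eX heX hcokX) hcount⟩

end Pointwise

/-! ## §3 The fact-level theorem: the core package from the hull sub-package, H2X⁺, FW, Lim and Imai's finiteness -/

section Facts

/-- **`exists_memberHullZetaFineInputs → H2X⁺ → Lim 3.5 → FW → (Imai) → exists_memberHullZetaCoreInputs`.**  At the member `W_K` of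
the hull fact: `W_K[p]` is reducible and `0 ≤ ord_p j(W_K)` (isogeny invariance), `W_K(ℚ_{p,∞})[p^∞]` is finite (Imai's schema at
`W_K`), so H2X⁺ gives `J ⊇ X₀(W_K/ℚ_∞)` with finite cokernel and — `W_K(ℚ)` being finite BY CLAUSE (b′) OF THE PACKAGE
(`ZetaLineRankZero.finite_point_of_zetaLineOrthIndexAt`, Poitou–Tate over `ℚ` a tree theorem) and `Ш(W_K)[p^∞]` by isogeny
invariance — the count (c2′) for `J`; §2 assembles the core package.  The displayed `hImai` is Imai's theorem [for an abelian
variety with good reduction over a finite `K/ℚ_p`, `A(K(μ_{p^∞}))_tors` is finite] over a field of good reduction, in the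
schema shape of bsd-cm's `ContraRealizable` files (not minted as a fact here).
[cite: Kato2004Asterisque, Thm. 12.5 (1)–(3) (pp. 221–222), Cor. 14.3 and Thm. 14.5 (pp. 235–236), (14.9.1) (p. 239), (14.9.3) (p. 240), §14.14 (14.14.1)–(14.14.2) (p. 243), Prop. 14.16 (2) (pp. 244–245)]
[cite: Imai1975, Theorem (p. 12)] [cite: SilvermanAEC2009, Cor. VII.7.2 and Prop. VII.5.5] [cite: Wuthrich2014, Lemma 14 (p. 396)] -/
theorem exists_memberHullZetaCoreInputs_of_fineInputs (hF : exists_memberHullZetaFineInputs)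
    (hH : exists_iwasawaH2Data_fineSelmerDual_embedding_count)
    (hLim : Lim2017.thm35_fineSelmerDual_moduleFinite_of_classicalMuVanishes_of_le_divisionField)
    (hFW : Literature.NumberTheory.IwasawaTheory.ferreroWashington1979_classicalMuVanishes)
    (hImai : ∀ (W : WeierstrassCurve ℚ) [W.IsElliptic] (p : ℕ) [Fact p.Prime] (κ : ZpExtension ℚ p)
      (v : HeightOneSpectrum (𝓞 ℚ)), 0 ≤ padicValRat p W.j → κ.IsCyclotomic →
      ((Rat.HeightOneSpectrum.primesEquiv v : Nat.Primes) : ℕ) = p →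
      Finite (FixedPoints.addSubgroup ↥(κ.kerSubgroup ⊓ GreenbergSelmer.decomp v) (W.geomPrimaryTorsion p))) :
    exists_memberHullZetaCoreInputs := by
  intro W _ _ p _ hp hgood hmult hj hirr hL hsha
  have hpp : p.Prime := Fact.out
  have hPT : poitouTate_selmerStructure_duality ℚ :=
    poitouTate_selmerStructure_duality_of_conj (InputsPoitouTateSelmer.poitouTate_selmerStructure_duality_conj_holds ℚ)
  obtain ⟨W', hW'e, hW'm, hiso, hrest⟩ := hF W p hp hgood hmult hj hirr hL hsha
  haveI := hW'e
  haveI := hW'm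
  -- transports along the isogeny `W ∼ W'`
  have hirr' : ¬ W'.HasIrreducibleModPGaloisRep p := Rank1Residual.not_hasIrreducibleModPGaloisRep_of_isIsogenous hiso hirr
  obtain ⟨φ⟩ := hiso
  have hj' : 0 ≤ padicValRat p W'.j := padicValRat_j_nonneg_of_isogeny φ hpp hj
  have hshaW' : W'.ShaFinite := (show IsIsogenous W W' from ⟨φ⟩).shaFinite_iff_shaFinite.mp hsha
  haveI : Finite W'.sha := hshaW'
  refine ⟨W', hW'e, hW'm, ⟨φ⟩, ?_⟩
  intro _ _ _ N _ f hf ι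
  obtain ⟨κ', Λ', c, d, a, A, z, x, hκ', hA, hc, hd, hZB, hall⟩ := hrest f hf ι
  refine ⟨κ', Λ', c, d, a, A, z, x, hκ', hA, hc, hd, hZB, ?_⟩
  intro κ γ hκ hγ I y hy
  obtain ⟨Z⟩ := hall κ γ hκ hγ I y hy
  -- the place of `ℚ` at `p` and Imai's finiteness at the member
  let v : HeightOneSpectrum (𝓞 ℚ) := Rat.HeightOneSpectrum.primesEquiv.symm ⟨p, hpp⟩
  have hv : ((Rat.HeightOneSpectrum.primesEquiv v : Nat.Primes) : ℕ) = p := by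
    simp only [v, Equiv.apply_symm_apply]
  have hfin := hImai W' p κ v hj' hκ hv
  -- `W'(ℚ)` finite from clause (b′) of the package; `Ш(W')[p^∞]` finite from `Ш(W)` finite
  haveI : Finite W'.toAffine.Point := by
    obtain ⟨q, -, e, -, hZL⟩ := Z.zetaLineIndex
    exact ZetaLineRankZero.finite_point_of_zetaLineOrthIndexAt W' p hPT hp
      (layerZeroToTop_mem_integralH1 W' p κ (I.proj_mem 0 y)) hZL
  haveI : Finite (AddCommGroup.primaryComponent W'.sha p) := inferInstance
  -- H2X⁺ at the member, and the assembly of §2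
  obtain ⟨J, eX, heX, hcokX, hc⟩ := hH W' p κ γ hγ v hp hκ hv hfin I
  exact nonempty_coreInputs_of_fineInputs W' p hLim hFW hp hκ hγ hirr' Z J eX heX hcokX (hc inferInstance inferInstance)

/-- **THE O6 NODE BEHIND CRUX M from modularity, the hull sub-package, H2X⁺, Lim 3.5, FW and Imai's finiteness** —
`Rank1Residual.O6.KatoMemberShaBoundOfReducible` (§3, then seat g25's `ZetaLineRankZero.katoMemberShaBoundOfReducible_of_newform_of_coreInputs`;
no Gross–Zagier–Kolyvagin, no Poitou–Tate hypothesis).  Route-free; the typed closers of M on K9 / K8-t′ are one-liners over this.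
[cite: Kato2004Asterisque, Thm. 12.5/12.6 (p. 222), Lemma 13.10 (1) (p. 230), Cor. 14.3 / Thm. 14.5 (pp. 235–236), (14.9.1)–(14.9.3) (pp. 239–240), (14.14.1)–(14.14.2) (p. 243), Prop. 14.16 (2) (pp. 244–245)]
[cite: Imai1975, Theorem (p. 12)] [cite: Kim2022StructureSelmer, §3.2.3] -/
theorem katoMemberShaBoundOfReducible_of_newform_of_fineInputs (hmod : exists_isNewformOf)
    (hF : exists_memberHullZetaFineInputs) (hH : exists_iwasawaH2Data_fineSelmerDual_embedding_count)
    (hLim : Lim2017.thm35_fineSelmerDual_moduleFinite_of_classicalMuVanishes_of_le_divisionField)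
    (hFW : Literature.NumberTheory.IwasawaTheory.ferreroWashington1979_classicalMuVanishes)
    (hImai : ∀ (W : WeierstrassCurve ℚ) [W.IsElliptic] (p : ℕ) [Fact p.Prime] (κ : ZpExtension ℚ p)
      (v : HeightOneSpectrum (𝓞 ℚ)), 0 ≤ padicValRat p W.j → κ.IsCyclotomic →
      ((Rat.HeightOneSpectrum.primesEquiv v : Nat.Primes) : ℕ) = p →
      Finite (FixedPoints.addSubgroup ↥(κ.kerSubgroup ⊓ GreenbergSelmer.decomp v) (W.geomPrimaryTorsion p))) :
    Rank1Residual.O6.KatoMemberShaBoundOfReducible :=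
  ZetaLineRankZero.katoMemberShaBoundOfReducible_of_newform_of_coreInputs hmod
    (exists_memberHullZetaCoreInputs_of_fineInputs hF hH hLim hFW hImai)

/-- **The reducible UPPER HALF behind U₀-red (`MissingUpperBoundAt` at `r_an = 0`) from the same atoms** (§3, then seat g25's
`ReducibleUpperOfCoreInputs.missingUpperBoundAt_of_coreInputs'`), with the U₀-red nodes' other held inputs (modularity, Cassels,
GZK, entire `L`) displayed as there.  Route-free. [cite: Kato2004Asterisque, §14.14 (p. 243), proof of Prop. 14.16 (pp. 244–245)] [cite: Imai1975, Theorem (p. 12)] -/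
theorem missingUpperBoundAt_of_fineInputs (hne : Kato2004.nonempty_iwasawaH1Data) (hmod : exists_isNewformOf)
    (hF : exists_memberHullZetaFineInputs) (hH : exists_iwasawaH2Data_fineSelmerDual_embedding_count)
    (hLim : Lim2017.thm35_fineSelmerDual_moduleFinite_of_classicalMuVanishes_of_le_divisionField)
    (hFW : Literature.NumberTheory.IwasawaTheory.ferreroWashington1979_classicalMuVanishes)
    (hImai : ∀ (W : WeierstrassCurve ℚ) [W.IsElliptic] (p : ℕ) [Fact p.Prime] (κ : ZpExtension ℚ p)
      (v : HeightOneSpectrum (𝓞 ℚ)), 0 ≤ padicValRat p W.j → κ.IsCyclotomic →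
      ((Rat.HeightOneSpectrum.primesEquiv v : Nat.Primes) : ℕ) = p →
      Finite (FixedPoints.addSubgroup ↥(κ.kerSubgroup ⊓ GreenbergSelmer.decomp v) (W.geomPrimaryTorsion p)))
    (hCassels : bsdRHS_eq_of_isIsogenous) (hGZK : rank_eq_analyticRank_of_analyticRank_le_one)
    (hmodL : hasEntireLFunction_rat)
    (W : WeierstrassCurve ℚ) [W.IsElliptic] [W.IsGloballyMinimal] (p : ℕ) [Fact p.Prime]
    (hp : p ≠ 2) (hng : ¬ W.HasGoodReductionAtPrime p) (hnm : ¬ W.HasMultiplicativeReductionAtPrime p)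
    (hj : 0 ≤ padicValRat p W.j) (hred : ¬ W.HasIrreducibleModPGaloisRep p)
    (hr : W.analyticRank = 0) : MissingUpperBoundAt W p :=
  ReducibleUpperOfCoreInputs.missingUpperBoundAt_of_coreInputs' hne hmod
    (exists_memberHullZetaCoreInputs_of_fineInputs hF hH hLim hFW hImai) hCassels hGZK hmodL W p hp hng hnm hj hred hr

end Facts

end Summit.BirchSwinnertonDyer.BirchSwinnertonDyer.Theorems.CoreInputsOfFine

end
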